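import Summits.Ventures.LatticeQCDFlow.Scaling.SectorExactManySectorsLaw
import Summits.Ventures.LatticeQCDFlow.Scaling.DominatedStarLogSobolevMixing

/-!
HONEST FRAMING: exact (Metropolis-corrected) sampling algorithms for lattice gauge theory; figures
of merit are autocorrelation/cost numbers at stated couplings and volumes; no continuum-physics
claim.

# SectorExactLogSobolevLaw — ITEM 1 FOR PARTITION-EXACT FLOWS WITH ANY NUMBER OF SECTORS, WITH `log log` OF THE LABEL ENTROPY:
# `2d_L(n)² ≤ (1 − h·G·α₀)ⁿ·log(1/π̃^L_min)`, `G = p·min{ct/(3m), h/(7K)}`, `α₀` THE LOG-SOBOLEV CONSTANT OF THE WORST LABEL REDRAW, AND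
# `t_mix(ε) ≤ max{2⌈ρ⁻¹·log(2(1+K(2t+h)/(2t))/ε)⌉, ⌈(h·G·α₀)⁻¹·log(2·log(1/π̃^L_min)/ε²)⌉}` — THE `K·log(1/w_min)` OF FILE 14 BECOMES
# `log(K·log(1/w_min))/α₀` (lean-2 GEN-30, ours)

Venture-side (OURS).  Cell `lqcd-flow` (pub-lqcd), unit `pub-lqcd-lean-2-g30`, 2026-08-28.  Chapter Q (item 1 for sector-exact maps on a
general `S`), file 15.  `Scaling/SectorExactManySectorsLaw` bounded the `q`-point label star spectrally (chapter N's regime-free gap), paying the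
label entropy `log(1/π̃^L_min) ≤ (K+1)log(1/w_min)` once.  Chapter N's HYPERCONTRACTIVE route (`Scaling/DominatedStarLogSobolevMixing`, N14: the
exact-product comparison needs only reversible cold kernels, so idle cold labels qualify) applies verbatim to the label star and replaces the
entropy by its logarithm: with `α₀ ≤ α(μ^L_k, E_k)` the log-Sobolev constant of the redraw from each label law
(`≥ (1−2w_*)/log((1−w_*)/w_*)` by `exactRedraw_logSobolevConst_ge`), Miclo's bound gives `2d_L(n)² ≤ (1 − h·G·α₀)ⁿ·log(1/π̃^L_min)`.

## What is proved

* **`labelStar_worstTvDist_sq_le_logSobolev`** — the label star on `L` (`|L| ≥ 2`, `K ≥ 1`, hub domination `p·μ^L_{κ_r+1} ≤ μ^L_0`, `0 < p ≤ 1`,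
  `c ≥ 1`, `0 < t < 1`, `w_0 > 0`; `α₀ ≤ α(μ^L_k, E_k)` for every `k`): **`2d_L(n)² ≤ (1 − h·G·α₀)ⁿ·log(1/π̃^L_min)`**, `G = p·min{ct/(3m), h/(7K)}`;
* **`sectorExact_mixingTime_le_logSobolev`** — partition-exact flows `ℓ : S → L` with ANY number of sectors (`p·c_r(b) ≤ 1`), exact hot redraws,
  stationary sector-confined cold kernels, `0 < α₀`, `0 < π̃^L_min < 1`:
  **`t_mix(ε) ≤ max{2⌈ρ⁻¹·log(2(1+K(2t+h)/(2t))/ε)⌉, ⌈(h·G·α₀)⁻¹·log(2·log(1/π̃^L_min)/ε²)⌉}`**, `ρ = (th/(2t+h))·min{hpc/m, 1/(K+1)}`.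

Reading (no numerics implied): `O((K + m/(hpc))(1/t+1/h)·log(K/ε) + (m/(ctp) + K/(hp))·(1/(h·α₀))·(log(K·log(1/w_min)) + log(1/ε)))` with
`1/α₀ ≈ log(1/w_min)`: for partition-exact flows the cold-start law of the persistent hub is polynomial in `K` with the conjectured `K·log K` growth at
uniform listing, linear in `1/p`, free of `|S|` and of any regime, the sector weights entering through `log(1/w_min)·log log(1/w_min)` and one extra
`1/h`.  What OPEN-MATH item 1 still asks of the `q`-point star (`q ≥ 3`) is a COUPLING law: the removal of the last `1/h` and of `log(1/w_min)`.
NOT CLAIMED: flows inexact within a sector; anything measured.  Literature grade (cell rule): OWN; cites the tree's Miclo (1997) Cor. 7 bound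
(`Miclo1997_worstTvDist_sq_le`); no new bib keys.
-/

noncomputable section

open Finset Function
open Literature.Probability.MarkovChains

namespace Summit.Ventures.LatticeQCDFlow.Scaling

variable {S : Type*} [Fintype S] [DecidableEq S] {K m : ℕ} {μ : Fin (K + 1) → S → ℝ} {M : Fin (K + 1) → S → S → ℝ}
  {w : Fin (K + 1) → ℝ} {t : ℝ}

section LogSobolev
variable (κ : Fin m → Fin K) (φ : Fin m → Equiv.Perm S) {L : Type*} [Fintype L] [DecidableEq L] (ℓ : S → L)

omit [Fintype S] [DecidableEq S] in
/-- `2d² ≤ B ≤ ε²/2`, `d ≥ 0`, `ε > 0` ⇒ `d ≤ ε/2`. [ours] -/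
theorem le_half_of_two_sq_le {d ε B : ℝ} (hd : 0 ≤ d) (hε : 0 < ε) (h : 2 * d ^ 2 ≤ B) (hB : B ≤ ε ^ 2 / 2) :
    d ≤ ε / 2 := by
  nlinarith [h, hB, hd, hε]

omit [Fintype S] [DecidableEq S] in
/-- **From `2W(k)² ≤ (1−a)ᵏ·Lg` to `W(n) ≤ ε/2`** once `n ≥ N ≥ a⁻¹·log(2Lg/ε²)` (`0 < a ≤ 1`, `Lg > 0`, `W(n) ≥ 0`, `ε > 0`). [ours] -/
theorem le_half_of_geom_sq {W : ℕ → ℝ} {a Lg ε : ℝ} {n N : ℕ} (hsq : ∀ k, 2 * W k ^ 2 ≤ (1 - a) ^ k * Lg) (ha0 : 0 < a) (ha1 : a ≤ 1)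
    (hLg0 : 0 < Lg) (hW0 : 0 ≤ W n) (hε : 0 < ε) (hN : 1 / a * Real.log (2 * Lg / ε ^ 2) ≤ N) (hn : N ≤ n) : W n ≤ ε / 2 := by
  have hg := geom_le_of_ge_log ha0 ha1 (by positivity : 0 < 2 * Lg) (by positivity : 0 < ε ^ 2) hN
  have hpow : (1 - a) ^ n * Lg ≤ (1 - a) ^ N * Lg :=
    mul_le_mul_of_nonneg_right (pow_le_pow_of_le_one (by linarith) (by linarith) hn) hLg0.le
  exact le_half_of_two_sq_le hW0 hε (hsq n) (by linarith)

omit [Fintype S] [DecidableEq S] in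
/-- **THE LABEL STAR'S DISTANCE, HYPERCONTRACTIVELY:** `2d_L(n)² ≤ (1 − (1−t)w_0·G·α₀)ⁿ·log(1/π̃^L_min)`, `G = p·min{ct/(3m), (1−t)w_0/(7K)}`, for the
label star on `L` (`|L| ≥ 2`, `K ≥ 1`, positive label laws summing to one with hub domination, `0 < p ≤ 1`, `c ≥ 1`, `0 < t < 1`, `w_0 > 0`,
`α₀ ≤ α(μ^L_k, E_k)` for every level, `0 < π̃^L_min ≤ π̃_L`) — N14's `α(PP̃) ≥ h·G·α₀` on the label star and Miclo's Cor. 7. [ours] -/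
theorem labelStar_worstTvDist_sq_le_logSobolev [Nontrivial L] (hK : 1 ≤ K) (hm : 1 ≤ m) (ht0 : 0 < t) (ht1 : t < 1) (hw0 : ∀ k, 0 ≤ w k)
    (hw00 : 0 < w 0) (hw1 : ∑ k, w k = 1) {μB : Fin (K + 1) → L → ℝ} (hμB0 : ∀ k b, 0 < μB k b) (hμB1 : ∀ k, ∑ b, μB k b = 1)
    {p : ℝ} (hp0 : 0 < p) (hp1 : p ≤ 1) (hdomB : ∀ (r : Fin m) (b : L), p * μB (κ r).succ ((fun _ : Fin m => Equiv.refl L) r b) ≤ μB 0 b)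
    {c : ℕ} (hc1 : 1 ≤ c) (hc : ∀ p' : Fin K, c ≤ (univ.filter (fun r : Fin m => κ r = p')).card)
    {α₀ : ℝ} (hα : ∀ k, α₀ ≤ logSobolevConst (μB k) (fun _ v : L => μB k v))
    {πLmin : ℝ} (hmin0 : 0 < πLmin) (hmin : ∀ s, πLmin ≤ tensorFun μB s) (n : ℕ) :
    2 * worstTvDist (fun y s : Fin (K + 1) → L =>
        t * ptGraphSwap μB (fun r : Fin m => (((0 : Fin (K + 1)), (κ r).succ) : Fin (K + 1) × Fin (K + 1)))
            (fun _ : Fin m => Equiv.refl L) y s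
          + (1 - t) * prodKernel w (fun (k : Fin (K + 1)) (u v : L) => if k = 0 then μB 0 v else (if u = v then (1 : ℝ) else 0)) y s)
      (tensorFun μB) n ^ 2
      ≤ (1 - (1 - t) * w 0 * (p * min (c * t / (3 * m)) ((1 - t) * w 0 / (7 * K)) * α₀)) ^ n * Real.log (1 / πLmin) := by
  set MB : Fin (K + 1) → L → L → ℝ := fun k u v => if k = 0 then μB 0 v else (if u = v then (1 : ℝ) else 0) with hMB
  have hMBs : ∀ k, IsRowStochastic (MB k) := fun k => by
    refine ⟨fun u v => ?_, fun u => ?_⟩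
    · rw [hMB]; dsimp only; split_ifs; exacts [(hμB0 0 v).le, zero_le_one, le_rfl]
    · rw [hMB]; dsimp only
      by_cases hk : k = 0
      · simp only [hk, if_true]; exact hμB1 0
      · simp only [hk, if_false]; rw [Finset.sum_ite_eq univ u, if_pos (mem_univ _)]
  have hMBrev : ∀ k, DetailedBalance (μB k) (MB k) := fun k => by
    intro u v
    rw [hMB]; dsimp only
    by_cases hk : k = 0
    · subst hk; simp only [if_true]; ring
    · simp only [hk, if_false]
      by_cases huv : u = v
      · subst huv; rfl
      · rw [if_neg huv, if_neg (Ne.symm huv), mul_zero, mul_zero]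
  have hMB0 : ∀ u v, MB 0 u v = μB 0 v := fun u v => by rw [hMB]; simp
  have hKr : (1 : ℝ) ≤ K := by exact_mod_cast hK
  have hmpos : (0 : ℝ) < m := Nat.cast_pos.mpr (by omega)
  have hcpos : (0 : ℝ) < c := Nat.cast_pos.mpr (by omega)
  have h1t : 0 < 1 - t := by linarith
  set G := p * min (c * t / (3 * m)) ((1 - t) * w 0 / (7 * K)) with hG
  have hG0 : 0 < G := mul_pos hp0 (lt_min (by positivity) (by positivity))
  have hG1 : G * (3 * m) ≤ p * c * t := by
    calc G * (3 * m) ≤ p * (c * t / (3 * m)) * (3 * m) :=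
          mul_le_mul_of_nonneg_right (mul_le_mul_of_nonneg_left (min_le_left _ _) hp0.le) (by positivity)
      _ = p * c * t := by field_simp
  have hG2 : G * (p + 6 * K) ≤ p * 1 * (1 - t) * w 0 := by
    have h3 : (p + 6 * (K : ℝ)) ≤ 7 * K := by nlinarith
    calc G * (p + 6 * K) ≤ p * ((1 - t) * w 0 / (7 * K)) * (7 * K) :=
          mul_le_mul (mul_le_mul_of_nonneg_left (min_le_right _ _) hp0.le) h3 (by positivity) (by positivity)
      _ = p * 1 * (1 - t) * w 0 := by field_simp
  have hP := weightedScheme_isRowStochastic (ptGraphSwap_isRowStochastic (e := fun r : Fin m =>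
      (((0 : Fin (K + 1)), (κ r).succ) : Fin (K + 1) × Fin (K + 1))) (φ := fun _ : Fin m => Equiv.refl L) hμB0) hMBs hw0 hw1 ht0.le ht1.le
  have hDB := weightedScheme_detailedBalance (w := w) (ptGraphSwap_detailedBalance (e := fun r : Fin m =>
      (((0 : Fin (K + 1)), (κ r).succ) : Fin (K + 1) × Fin (K + 1))) (φ := fun _ : Fin m => Equiv.refl L) hμB0) hMBrev t
  have hlow := dominatedStar_logSobolevConst_sq_ge κ (fun _ : Fin m => Equiv.refl L) (μ := μB) (M := MB) hm hμB0 hμB1 hMBs hMBrev hMB0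
    hw0 hw1 hw00 ht0 ht1 hp0 hdomB hc1 hc hG0 hG1 hG2 hα
  have hMiclo := Miclo1997_worstTvDist_sq_le (tensorFun_pos hμB0) (sum_tensorFun_eq_one μB hμB1) hP (hDB.isStationary hP.2) hmin0 hmin n
  have hhalf := logSobolevConst_mulReversibilization_le_half (tensorFun_pos hμB0) (sum_tensorFun_eq_one μB hμB1) hP (hDB.isStationary hP.2)
  have hlog0 : 0 ≤ Real.log (1 / πLmin) := by
    apply Real.log_nonneg
    rw [le_div_iff₀ hmin0, one_mul]
    obtain ⟨s⟩ := (inferInstance : Nonempty (Fin (K + 1) → L))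
    calc πLmin ≤ tensorFun μB s := hmin s
      _ ≤ ∑ y, tensorFun μB y := Finset.single_le_sum (fun y _ => (tensorFun_pos hμB0 y).le) (mem_univ s)
      _ = 1 := sum_tensorFun_eq_one μB hμB1
  calc _ ≤ _ := hMiclo
    _ ≤ (1 - (1 - t) * w 0 * (G * α₀)) ^ n * Real.log (1 / πLmin) :=
        mul_le_mul_of_nonneg_right (pow_le_pow_left₀ (by linarith) (by linarith) n) hlog0

/-- **THE `log log` MIXING TIME WITH PARTITION-EXACT FLOWS AND ANY NUMBER OF SECTORS** (`θ = 2t/(2t+h)`, `h = (1−t)w_0`, `G = p·min{ct/(3m), h/(7K)}`,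
`0 < α₀ ≤ α(μ^L_k, E_k)`, `0 < π̃^L_min < 1`):
**`t_mix(ε) ≤ max{2⌈ρ⁻¹·log(2(1+K(2t+h)/(2t))/ε)⌉, ⌈(h·G·α₀)⁻¹·log(2·log(1/π̃^L_min)/ε²)⌉}`**, `ρ = (th/(2t+h))·min{hpc/m, 1/(K+1)}` — free of `|S|` and of any
regime, the label entropy under one more logarithm. [ours] -/
theorem sectorExact_mixingTime_le_logSobolev [Nontrivial L] (hK : 1 ≤ K) (hm : 1 ≤ m) (ht0 : 0 < t) (ht1 : t < 1) (hw0 : ∀ k, 0 ≤ w k)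
    (hw00 : 0 < w 0) (hw1 : ∑ k, w k = 1) (hμ : ∀ k x, 0 < μ k x) (hμ1 : ∀ k, ∑ u, μ k u = 1) (hφℓ : ∀ r u, ℓ (φ r u) = ℓ u)
    {cL : Fin m → L → ℝ} (hcL : ∀ r b, 0 < cL r b) (hexact : ∀ r u, μ (κ r).succ (φ r u) = cL r (ℓ u) * μ 0 u)
    (hM : ∀ k, IsRowStochastic (M k)) (hM0 : ∀ u v, M 0 u v = μ 0 v)
    (hstat : ∀ k : Fin (K + 1), k ≠ 0 → ∀ v, ∑ u, μ k u * M k u v = μ k v)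
    (hconf : ∀ k : Fin (K + 1), k ≠ 0 → ∀ u v, ℓ u ≠ ℓ v → M k u v = 0)
    {μB : Fin (K + 1) → L → ℝ} (hμB : ∀ k b, μB k b = ∑ u ∈ univ.filter (fun u => ℓ u = b), μ k u)
    (hμB0 : ∀ k b, 0 < μB k b) {p : ℝ} (hp0 : 0 < p) (hp1 : p ≤ 1) (hpc : ∀ r b, p * cL r b ≤ 1)
    {c : ℕ} (hc1 : 1 ≤ c) (hc : ∀ p' : Fin K, c ≤ (univ.filter (fun r : Fin m => κ r = p')).card)
    {α₀ : ℝ} (hα0 : 0 < α₀) (hα : ∀ k, α₀ ≤ logSobolevConst (μB k) (fun _ v : L => μB k v))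
    {πLmin : ℝ} (hmin0 : 0 < πLmin) (hmin1 : πLmin < 1) (hmin : ∀ s, πLmin ≤ tensorFun μB s) {ε : ℝ} (hε : 0 < ε) :
    mixingTime (fun y z : Fin (K + 1) → S =>
        t * ptGraphSwap μ (fun r : Fin m => (((0 : Fin (K + 1)), (κ r).succ) : Fin (K + 1) × Fin (K + 1))) φ y z
          + (1 - t) * prodKernel w M y z) (tensorFun μ) ε
      ≤ max (2 * ⌈1 / (t * ((1 - t) * w 0) / (2 * t + (1 - t) * w 0) * min ((1 - t) * w 0 * p * c / m) (1 / (K + 1)))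
              * Real.log (2 * (1 + K * (2 * t + (1 - t) * w 0) / (2 * t)) / ε)⌉₊)
          ⌈1 / ((1 - t) * w 0 * (p * min (c * t / (3 * m)) ((1 - t) * w 0 / (7 * K)) * α₀))
              * Real.log (2 * Real.log (1 / πLmin) / ε ^ 2)⌉₊ := by
  set h := (1 - t) * w 0 with hh
  have hh0 : 0 < h := mul_pos (by linarith) hw00
  have hmpos : (0 : ℝ) < m := Nat.cast_pos.mpr (by omega)
  have hKr : (1 : ℝ) ≤ K := by exact_mod_cast hK
  have hcpos : (0 : ℝ) < c := Nat.cast_pos.mpr (by omega)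
  obtain ⟨hμB1, -, -, -, hdomB⟩ := labelStar_basic κ φ ℓ hμ1 hφℓ hexact hμB hμB0 hpc
  -- the tuned `θ` and the stale rate (as in file 14)
  set θ := 2 * t / (2 * t + h) with hθ
  have hθ0 : 0 < θ := by positivity
  have hθ1 : θ ≤ 1 := by rw [hθ, div_le_one (by positivity)]; linarith
  have h1θ : 1 - θ = h / (2 * t + h) := by rw [hθ]; field_simp; ring
  have hreg : (1 - θ) * t ≤ (1 - t) * w 0 * θ := by
    rw [h1θ, ← hh, hθ]
    rw [div_mul_eq_mul_div, mul_div_assoc', div_le_div_iff_of_pos_right (by positivity)]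
    nlinarith [mul_pos ht0 hh0]
  set ρ := t * h / (2 * t + h) * min (h * p * c / m) (1 / (K + 1)) with hρ
  have hρ0 : 0 < ρ := by
    have : 0 < min (h * p * c / (m : ℝ)) (1 / ((K : ℝ) + 1)) := lt_min (by positivity) (by positivity)
    positivity
  have hρ1 : ρ ≤ 1 := by
    have h1 : t * h / (2 * t + h) ≤ 1 := by rw [div_le_one (by positivity)]; nlinarith [mul_pos ht0 hh0]
    have h2 : min (h * p * c / (m : ℝ)) (1 / ((K : ℝ) + 1)) ≤ 1 := (min_le_right _ _).trans (by
      rw [div_le_one (by positivity)]; linarith [Nat.cast_nonneg (α := ℝ) K])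
    have h3 : 0 ≤ min (h * p * c / (m : ℝ)) (1 / ((K : ℝ) + 1)) := le_min (by positivity) (by positivity)
    calc ρ ≤ 1 * 1 := mul_le_mul h1 h2 h3 zero_le_one
      _ = 1 := one_mul 1
  -- the label rate `a = h·G·α₀ ≤ α(PP̃) ≤ 1/2` (kept literal: it is the exponent base of file 15's first theorem)
  have h1t : 0 < 1 - t := by linarith
  set MB : Fin (K + 1) → L → L → ℝ := fun k u v => if k = 0 then μB 0 v else (if u = v then (1 : ℝ) else 0) with hMB
  have hMBs : ∀ k, IsRowStochastic (MB k) := fun k => by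
    refine ⟨fun u v => ?_, fun u => ?_⟩
    · rw [hMB]; dsimp only; split_ifs; exacts [(hμB0 0 v).le, zero_le_one, le_rfl]
    · rw [hMB]; dsimp only
      by_cases hk : k = 0
      · simp only [hk, if_true]; exact hμB1 0
      · simp only [hk, if_false]; rw [Finset.sum_ite_eq univ u, if_pos (mem_univ _)]
  have hMBrev : ∀ k, DetailedBalance (μB k) (MB k) := fun k => by
    intro u v
    rw [hMB]; dsimp only
    by_cases hk : k = 0
    · subst hk; simp only [if_true]; ring
    · simp only [hk, if_false]
      by_cases huv : u = v
      · subst huv; rfl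
      · rw [if_neg huv, if_neg (Ne.symm huv), mul_zero, mul_zero]
  have hMB0 : ∀ u v, MB 0 u v = μB 0 v := fun u v => by rw [hMB]; simp
  have hG0' : 0 < (p * min (c * t / (3 * m)) ((1 - t) * w 0 / (7 * K))) := mul_pos hp0 (lt_min (by positivity) (by positivity))
  have hG1' : (p * min (c * t / (3 * m)) ((1 - t) * w 0 / (7 * K))) * (3 * m) ≤ p * c * t := by
    calc (p * min (c * t / (3 * m)) ((1 - t) * w 0 / (7 * K))) * (3 * m) ≤ p * (c * t / (3 * m)) * (3 * m) :=
          mul_le_mul_of_nonneg_right (mul_le_mul_of_nonneg_left (min_le_left _ _) hp0.le) (by positivity)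
      _ = p * c * t := by field_simp
  have hG2' : (p * min (c * t / (3 * m)) ((1 - t) * w 0 / (7 * K))) * (p + 6 * K) ≤ p * 1 * (1 - t) * w 0 := by
    have h3 : (p + 6 * (K : ℝ)) ≤ 7 * K := by nlinarith
    calc (p * min (c * t / (3 * m)) ((1 - t) * w 0 / (7 * K))) * (p + 6 * K) ≤ p * ((1 - t) * w 0 / (7 * K)) * (7 * K) :=
          mul_le_mul (mul_le_mul_of_nonneg_left (min_le_right _ _) hp0.le) h3 (by positivity) (by positivity)
      _ = p * 1 * (1 - t) * w 0 := by field_simp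
  have hP := weightedScheme_isRowStochastic (ptGraphSwap_isRowStochastic (e := fun r : Fin m =>
      (((0 : Fin (K + 1)), (κ r).succ) : Fin (K + 1) × Fin (K + 1))) (φ := fun _ : Fin m => Equiv.refl L) hμB0) hMBs hw0 hw1 ht0.le ht1.le
  have hDB := weightedScheme_detailedBalance (w := w) (ptGraphSwap_detailedBalance (e := fun r : Fin m =>
      (((0 : Fin (K + 1)), (κ r).succ) : Fin (K + 1) × Fin (K + 1))) (φ := fun _ : Fin m => Equiv.refl L) hμB0) hMBrev t
  have hlow := dominatedStar_logSobolevConst_sq_ge κ (fun _ : Fin m => Equiv.refl L) (μ := μB) (M := MB) hm hμB0 hμB1 hMBs hMBrev hMB0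
    hw0 hw1 hw00 ht0 ht1 hp0 hdomB hc1 hc hG0' hG1' hG2' hα
  have hhalf := logSobolevConst_mulReversibilization_le_half (tensorFun_pos hμB0) (sum_tensorFun_eq_one μB hμB1) hP (hDB.isStationary hP.2)
  have ha0 : 0 < (1 - t) * w 0 * (p * min (c * t / (3 * m)) ((1 - t) * w 0 / (7 * K)) * α₀) := by positivity
  have ha1 : (1 - t) * w 0 * (p * min (c * t / (3 * m)) ((1 - t) * w 0 / (7 * K)) * α₀) ≤ 1 := by linarith only [hlow, hhalf]
  have hLg0 : 0 < Real.log (1 / πLmin) := Real.log_pos (by rw [lt_div_iff₀ hmin0]; linarith only [hmin1])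
  -- the two horizons
  set C₁ := 1 + K * (2 * t + h) / (2 * t) with hC₁
  have hC₁0 : 0 < C₁ := by positivity
  set N₁ : ℕ := ⌈1 / ρ * Real.log (2 * C₁ / ε)⌉₊ with hN₁
  set N₂ : ℕ := ⌈1 / ((1 - t) * w 0 * (p * min (c * t / (3 * m)) ((1 - t) * w 0 / (7 * K)) * α₀)) * Real.log (2 * Real.log (1 / πLmin) / ε ^ 2)⌉₊ with hN₂
  set n : ℕ := max (2 * N₁) N₂ with hn
  -- the decomposition at time `n`
  have h1 := sectorExact_worstTvDist_le_labelStar_dom κ φ ℓ hm ht0.le ht1.le hw0 hw1 hμ hμ1 hφℓ hcL hexact hM hM0 hstat hconf hμB hμB0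
    hp0.le hpc hθ0 hθ1 hreg hc n
  -- the stale term `≤ ε/2`
  have hrate : ρ ≤ min ((1 - t) * w 0 * (1 - θ) * p * c * t / m) (((1 - t) * w 0 * θ - (1 - θ) * t) / (K + θ)) := by
    refine le_min ?_ ?_
    · calc ρ ≤ t * h / (2 * t + h) * (h * p * c / m) := mul_le_mul_of_nonneg_left (min_le_left _ _) (by positivity)
        _ = (1 - t) * w 0 * (1 - θ) * p * c * t / m := by rw [h1θ, ← hh]; ring
    · calc ρ ≤ t * h / (2 * t + h) * (1 / (K + 1)) := mul_le_mul_of_nonneg_left (min_le_right _ _) (by positivity)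
        _ ≤ t * h / (2 * t + h) * (1 / (K + θ)) := by gcongr
        _ = ((1 - t) * w 0 * θ - (1 - θ) * t) / (K + θ) := by rw [← hh, h1θ, hθ]; field_simp; ring
  have hconst : (θ + K) / θ = C₁ := by rw [hC₁, hθ]; field_simp
  have hbase0 : 0 ≤ 1 - min ((1 - t) * w 0 * (1 - θ) * p * c * t / m) (((1 - t) * w 0 * θ - (1 - θ) * t) / (K + θ)) := by
    have h2 : min ((1 - t) * w 0 * (1 - θ) * p * c * t / m) (((1 - t) * w 0 * θ - (1 - θ) * t) / (K + θ))
        ≤ ((1 - t) * w 0 * θ - (1 - θ) * t) / (K + θ) := min_le_right _ _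
    have h3 : ((1 - t) * w 0 * θ - (1 - θ) * t) / (K + θ) ≤ 1 := by
      rw [div_le_one (by positivity)]
      have hw01 : w 0 ≤ 1 := by
        calc w 0 ≤ ∑ k, w k := Finset.single_le_sum (fun k _ => hw0 k) (mem_univ 0)
          _ = 1 := hw1
      have hA : (1 - t) * w 0 ≤ 1 := by nlinarith only [hw01, ht0.le, ht1.le, hw0 0]
      have hB : (1 - t) * w 0 * θ ≤ θ := by nlinarith only [hA, hθ0.le]
      have hC : 0 ≤ (1 - θ) * t := mul_nonneg (sub_nonneg.mpr hθ1) ht0.le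
      linarith only [hB, hC, Nat.cast_nonneg (α := ℝ) K]
    linarith only [h2, h3]
  have hn1 : N₁ ≤ n / 2 := by omega
  have hfirst : (θ + K) / θ * (1 - min ((1 - t) * w 0 * (1 - θ) * p * c * t / m)
      (((1 - t) * w 0 * θ - (1 - θ) * t) / (K + θ))) ^ (n / 2) ≤ ε / 2 := by
    have hg := geom_le_of_ge_log hρ0 hρ1 (by positivity : 0 < 2 * C₁) hε (n := N₁) (Nat.le_ceil _)
    calc (θ + K) / θ * (1 - min ((1 - t) * w 0 * (1 - θ) * p * c * t / m) (((1 - t) * w 0 * θ - (1 - θ) * t) / (K + θ))) ^ (n / 2)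
        ≤ C₁ * (1 - ρ) ^ (n / 2) := by
          rw [hconst]
          exact mul_le_mul_of_nonneg_left (pow_le_pow_left₀ hbase0 (by linarith only [hrate]) _) hC₁0.le
      _ ≤ C₁ * (1 - ρ) ^ N₁ := mul_le_mul_of_nonneg_left (pow_le_pow_of_le_one (by linarith only [hρ1]) (by linarith only [hρ0]) hn1) hC₁0.le
      _ = (2 * C₁ * (1 - ρ) ^ N₁) / 2 := by ring
      _ ≤ ε / 2 := by linarith only [hg]
  -- the label term `≤ ε/2`
  have hsq := fun k : ℕ =>
    labelStar_worstTvDist_sq_le_logSobolev κ hK hm ht0 ht1 hw0 hw00 hw1 hμB0 hμB1 hp0 hp1 hdomB hc1 hc hα hmin0 hmin k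
  have hdL0 := worstTvDist_nonneg (fun y s : Fin (K + 1) → L =>
        t * ptGraphSwap μB (fun r : Fin m => (((0 : Fin (K + 1)), (κ r).succ) : Fin (K + 1) × Fin (K + 1)))
            (fun _ : Fin m => Equiv.refl L) y s
          + (1 - t) * prodKernel w (fun (k : Fin (K + 1)) (u v : L) => if k = 0 then μB 0 v else (if u = v then (1 : ℝ) else 0)) y s)
      (tensorFun μB) n
  have hsecond := le_half_of_geom_sq hsq ha0 ha1 hLg0 hdL0 hε (N := N₂) (Nat.le_ceil _) (le_max_right _ _)
  refine mixingTime_le _ _ (t₀ := n) (h1.trans ?_)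
  linarith only [hfirst, hsecond]

end LogSobolev

end Summit.Ventures.LatticeQCDFlow.Scaling

end
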